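import Literature.NumberTheory.Automorphic.AutomorphicQuotientTransport      -- ★ p861590 (this seat): `quotL2`, `quotL2Equiv_rightRegular`, `DiscreteAutomorphicRep.mapAlong`, `mapAlongEquiv_toContRep_apply`
import Literature.NumberTheory.Automorphic.SmoothVectorsAlongGroupIso        -- ★ p861589 (this seat): `semiconj_comp_of_semiconj`, `map_smoothPart_eq_of_semiconj`
import Literature.NumberTheory.Automorphic.UnitaryGroupCohomologicalForms    -- ★ `DiscreteAutomorphicRep.finRep` (restriction along ★ `finAdelicToAdelic`)
import HarnessLib

/-!
# R90-TF · S9 «InnerForm-13.3.6 (c)» — (B3a-L²) a discrete automorphic representation of `U(J)` RIDES an equivariant measure-preserving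
# isomorphism of automorphic quotients `U(J)(F)\U(J)(𝔸_F) ≃ U(J′)(F)\U(J′)(𝔸_F)`, with its finite part and its smooth vectors

Cell `hodgecm-mathlib`, crux H413 (`stmt-HodgeConjecture-24833`, lane `--supports`), route of record `HCCMUnconditional` (no route verbs; count-neutral).  Programme
R90-TF (HUMAN RULING «R90-TF SLAB — MAX PUSH»; brief `director/R90-BRIEF.v2.md` 1f40d54518340a35), section S9 = InnerForm-13.3.6 (c) (base `R90-IF`); seat R90-IF-p03 (g0),
RE-DEALT BY NAME «p03 → B3a-L²» by R90-IF-plan (g0) (`R90/STATUS.md` 2026-09-04T15:40:04Z), beneath `R90.S9.sock_S9_similitudeTransport` (FILE B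
`Cruxes/H413/Lines/R90_S9_InnerFormTransportB.lean` :197 (B3), sub-socket (B3a) `sock_S9_congrDiscreteRep`).  ONE THEOREM, sorry-free, over ★ currency; the generic layer
(any two `AdelicGroupData`) is ★ `Literature/NumberTheory/Automorphic/AutomorphicQuotientTransport` + `SmoothVectorsAlongGroupIso` (this seat).  HONEST LABEL: HC_CM is
proved only modulo the 7 printed citations (2 remaining named inputs: hLiu418 = stmt-HodgeConjecture-24832, h413 = stmt-HodgeConjecture-24833) until rung 0 closes; this
file proves no printed statement about `U(3)` — it is representation-theoretic PLUMBING: the hypotheses `(e, Φ, hΦ, hΦe, e_f, he_f)` are p01's quotient-level layer BY SHAPE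
(for the rational similitude `ᵗB̄ (a • Φ₃) B = H`: `e = Ad(B)_𝔸` ★ `adelicUnitaryGroupCongr`, `Φ` the induced homeomorphism of `U(H)(L⁺)\U(H)(𝔸)` onto `U(Φ₃)(L⁺)\U(Φ₃)(𝔸)`,
`μ′ = Φ_* μ` automorphic), NOT constructed here.

DEPENDENCY CUT (CENSUS-FIRST, LEAD #12 (2)): (B3a) «`P ↦ P^B` is a discrete automorphic representation of `U(Φ₃)` with `P^B_f ≅ P_f ∘ Ad(B)_f⁻¹` and the same smooth
vectors» ⟸ THIS THEOREM ∘ ‹p01: `e, Φ, hΦe` + automorphy of `Φ_* μ`›; (B3b) `MemXiFamily` ∕ `LocalConstituentsIn` ∕ `IsConstituentOf` ride the delivered `U` place by place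
(p02, ★ `isConstituentOf_congr`, `θ_v = cmDatumLocalCongr …`); (B3c) ★ p861411 `R90.S9.πs_eq_of_charIdentityAtTestSigned`.

## References
* [BorelJacquet1979] A. Borel, H. Jacquet, *Automorphic forms and automorphic representations*, Proc. Sympos. Pure Math. 33 (1979), part 1, §4.6.
* [Rogawski1990] J. D. Rogawski, Ann. of Math. Stud. 123 (1990): §1.9 p. 8 (forms of `U(3)`), §14.2 p. 232.
* [PlatonovRapinchuk1994] V. Platonov, A. Rapinchuk, *Algebraic Groups and Number Theory* (1994), §2.3.
-/

set_option autoImplicit false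
-- the mandated namespace repeats `HodgeConjecture.HodgeConjecture`, as in every `Theorems/*.lean` of this sub-problem
set_option linter.dupNamespace false

noncomputable section

open NumberField IsDedekindDomain MeasureTheory
open Literature.NumberTheory.Automorphic Literature.NumberTheory.Automorphic.UnitaryGroup

namespace Summit.HodgeConjecture.HodgeConjecture.R90.S9

/-- **(B3a-L²) A DISCRETE AUTOMORPHIC REPRESENTATION OF `U(J)` RIDES AN EQUIVARIANT MEASURE-PRESERVING ISOMORPHISM OF AUTOMORPHIC QUOTIENTS.**
For the unitary adelic group data `𝒢 = adelicGroupData F E c N J`, `𝒢′ = adelicGroupData F E c N J′` (`A_G = 1`), a group isomorphism `e : U(J)(𝔸_F) ≃* U(J′)(𝔸_F)`,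
a measurable isomorphism `Φ` of the automorphic quotients which is `e`-equivariant (`Φ (g • x) = e g • Φ x`) and measure preserving (`μ ↦ μ′`), and a bicontinuous
isomorphism `e_f : U(J)(𝔸_{F,f}) ≃ₜ* U(J′)(𝔸_{F,f})` of the finite-adelic groups under `e` (`e ∘ (1, ·) = (1, ·) ∘ e_f`): every discrete automorphic representation `P`
of `U(J)` (w.r.t. `μ`) yields a discrete automorphic representation `P′` of `U(J′)` (w.r.t. `μ′`) — namely `U_Φ(P)`, `U_Φ f = f ∘ Φ⁻¹` (★ `DiscreteAutomorphicRep.mapAlong`)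
— with a topological linear isomorphism `U : P ≃L P′` which (i) is `U_Φ` on vectors, (ii) intertwines `P` and `P′` along `e` (`P′ ≅ P ∘ e⁻¹`), (iii) intertwines the
finite parts `P_f = P.finRep`, `P′_f` along `e_f`, and (iv) maps the smooth vectors of `P_f` ONTO those of `P′_f` (`U(P_f^∞) = P′_f^∞`).  Sorry-free over ★
`AutomorphicQuotientTransport` (`quotL2Equiv_rightRegular`, `mapAlongEquiv_toContRep_apply`) and ★ `SmoothVectorsAlongGroupIso` (`semiconj_comp_of_semiconj`,
`map_smoothPart_eq_of_semiconj`).  [cite: BorelJacquet1979, §4.6] [cite: Rogawski1990, §1.9 p. 8; §14.2 p. 232] [cite: PlatonovRapinchuk1994, §2.3] -/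
theorem exists_discreteAutomorphicRep_mapAlong
    {F E : Type} [Field F] [NumberField F] [Field E] [NumberField E] [Algebra F E] {c : E ≃ₐ[F] E} {N : ℕ} {J J' : Matrix (Fin N) (Fin N) E}
    {μ : Measure (adelicGroupData F E c N J).automorphicQuotient} {μ' : Measure (adelicGroupData F E c N J').automorphicQuotient}
    [SMulInvariantMeasure (adelicGroupData F E c N J).Adelic (adelicGroupData F E c N J).automorphicQuotient μ]
    [SMulInvariantMeasure (adelicGroupData F E c N J').Adelic (adelicGroupData F E c N J').automorphicQuotient μ']
    (e : (adelicGroupData F E c N J).Adelic ≃* (adelicGroupData F E c N J').Adelic)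
    (Φ : (adelicGroupData F E c N J).automorphicQuotient ≃ᵐ (adelicGroupData F E c N J').automorphicQuotient)
    (hΦ : MeasurePreserving Φ μ μ')
    (hΦe : ∀ (g : (adelicGroupData F E c N J).Adelic) (x : (adelicGroupData F E c N J).automorphicQuotient), Φ (g • x) = e g • Φ x)
    (ef : finAdelic F E c N J ≃ₜ* finAdelic F E c N J')
    (hef : ∀ x : finAdelic F E c N J, e (finAdelicToAdelic F E c N J x) = finAdelicToAdelic F E c N J' (ef x))
    (P : DiscreteAutomorphicRep (adelicGroupData F E c N J) μ) :
    ∃ (P' : DiscreteAutomorphicRep (adelicGroupData F E c N J') μ') (U : P.space.toSubmodule ≃L[ℂ] P'.space.toSubmodule),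
      (∀ w : P.space.toSubmodule, ((U w : P'.space.toSubmodule) : (adelicGroupData F E c N J').L2 μ') =
        quotL2 Φ hΦ ((w : P.space.toSubmodule) : (adelicGroupData F E c N J).L2 μ)) ∧
      (∀ (g : (adelicGroupData F E c N J).Adelic) (w : P.space.toSubmodule), U (P.space.toContRep g w) = P'.space.toContRep (e g) (U w)) ∧
      (∀ (x : finAdelic F E c N J) (w : P.space.toSubmodule), U (P.finRep x w) = P'.finRep (ef x) (U w)) ∧
      P.finRep.smoothPart.toSubmodule.map (U.toLinearEquiv : P.space.toSubmodule →ₗ[ℂ] P'.space.toSubmodule) = P'.finRep.smoothPart.toSubmodule := by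
  have hU : ∀ (g : (adelicGroupData F E c N J).Adelic) (w : P.space.toSubmodule),
      P.space.mapAlongEquiv (quotL2Equiv_rightRegular Φ hΦ e hΦe) (P.space.toContRep g w) =
        (P.mapAlong Φ hΦ e hΦe).space.toContRep (e g) (P.space.mapAlongEquiv (quotL2Equiv_rightRegular Φ hΦ e hΦe) w) :=
    fun g w => P.mapAlongEquiv_toContRep_apply Φ hΦ e hΦe g w
  have hUf : ∀ (x : finAdelic F E c N J) (w : P.space.toSubmodule),
      (P.space.mapAlongEquiv (quotL2Equiv_rightRegular Φ hΦ e hΦe)).toLinearEquiv (P.finRep x w) =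
        (P.mapAlong Φ hΦ e hΦe).finRep (ef x) ((P.space.mapAlongEquiv (quotL2Equiv_rightRegular Φ hΦ e hΦe)).toLinearEquiv w) :=
    fun x w => semiconj_comp_of_semiconj P.space.toContRep.toRepresentation (P.mapAlong Φ hΦ e hΦe).space.toContRep.toRepresentation
      (P.space.mapAlongEquiv (quotL2Equiv_rightRegular Φ hΦ e hΦe)).toLinearEquiv e (fun g w => hU g w)
      (finAdelicToAdelic F E c N J) (finAdelicToAdelic F E c N J') ef.toMulEquiv hef x w
  exact ⟨P.mapAlong Φ hΦ e hΦe, P.space.mapAlongEquiv (quotL2Equiv_rightRegular Φ hΦ e hΦe), fun w => rfl, hU, hUf,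
    map_smoothPart_eq_of_semiconj P.finRep (P.mapAlong Φ hΦ e hΦe).finRep
      (P.space.mapAlongEquiv (quotL2Equiv_rightRegular Φ hΦ e hΦe)).toLinearEquiv ef hUf⟩

end Summit.HodgeConjecture.HodgeConjecture.R90.S9

end
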